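import Mathlib
import HarnessLib
import Summits.NavierStokesRegularity.NavierStokesRegularity.Theses.RellichScar
import Literature.Analysis.FluidPDE.SuitableWeak
import Literature.Analysis.FluidPDE.LocalTypeI
import Literature.Analysis.FluidPDE.SlabPressureNormalization
import Summits.NavierStokesRegularity.NavierStokesRegularity.Theorems.RellichScarNoMildScarLimit
import Summits.NavierStokesRegularity.NavierStokesRegularity.Theorems.RellichScarNoMildScarTop
import Summits.NavierStokesRegularity.NavierStokesRegularity.Theorems.RellichScarNoMildScarFarField

/-!
# No mild scar under Type I (route RellichScar, item `NoMildScar`, stmt-NavierStokesRegularity-11723)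

PROOF of the support item `Summit.NavierStokesRegularity.NavierStokesRegularity.Theses.RellichScar.NoMildScar`:
the scar of an apex Type-I profile singular at the origin is not in `L³` near the origin.  Let
`(u, p)` be a suitable weak solution of Navier–Stokes (`ν = 1`, `f = 0`) on the backward slab
`(-∞, 0) × ℝ³` with a weak gradient `G`, Albritton–Barker quantity `𝐈 < ∞`, the apex bound
`‖u(t, x)‖ ≤ C/(‖x‖ + √(−t))` and a backward-singular origin, and suppose `σ ∈ L³(B(0, r))` were its
scar: `esssup_{(−δ,0)×K} |u − σ| → 0` as `δ ↓ 0` for every compact `K ∌ 0`.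

1. BLOW-UP (`exists_blowup_limit_apex`, `RellichScarNoMildScarLimit`): the zooms
   `u_c(s, y) = c u(c² s, c y)`, `c = 2^{-(k+1)}`, subconverge in `L³_loc` to an apex profile
   `(w, π, H)` singular at the origin (the tree's ENGINE `slab_typeI_compactness`, Albritton–Barker
   2019, Lemma 2.2 + Prop. 2.3), with the apex bound almost everywhere.
2. ZERO SCAR (`top_vanishing_of_scar`, `RellichScarNoMildScarTop`): since `L³` is scale critical,
   the zoomed scars `c σ(c ·)` tend to zero in `L³_loc` and `w` vanishes weakly at the final time.
3. RIGIDITY (`not_isBackwardSingularPoint_of_weakZeroScar`, this file, after ESS 2003 §3 through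
   the tree's `farField_curl_eq_zero` and the strip lemma of `RellichScarNoMildScarFarField`): the
   far-field vorticity of `w` vanishes by backward uniqueness across half-spaces, then everywhere on
   every strip below the final time by unique continuation, so the slices of `w` are harmonic,
   in `L⁴` by the apex bound, hence zero — `w = 0` a.e. on `]-1/3, 0[ × ℝ³`, contradicting the
   singularity of the origin.

* `not_isBackwardSingularPoint_of_weakZeroScar` — step 3;
* `rellichScar_noMildScar_proof : NoMildScar` — the item.

References: Escauriaza–Seregin–Šverák 2003 (backward uniqueness, Thm. 1.4 blow-up scheme);
Albritton–Barker 2019 = arXiv:1811.00502 (compactness and persistence of singularities);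
Seregin 2014, §6.6; Lemarié-Rieusset 2016, Thm. 15.4.
-/

noncomputable section

-- the summit and its single sub-problem share the name (CONVENTIONS §1), as in every Theorems file
set_option linter.dupNamespace false

namespace Summit.NavierStokesRegularity.NavierStokesRegularity.Theorems.RellichScarNoMildScar

open MeasureTheory Set Function Metric Filter Topology TopologicalSpace
open scoped ENNReal NNReal InnerProductSpace RealInnerProductSpace
open Literature.Analysis Literature.Analysis.FluidPDE

local notation "E³" => EuclideanSpace ℝ (Fin 3)

/-! ### Rigidity: an apex profile with weak zero scar is not singular at the origin -/

/-- **An apex profile which vanishes weakly at the final time is not singular at the origin**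
(ESS 2003, §3: far-field backward uniqueness + unique continuation + Liouville; the `L⁴` class of
the slices is supplied by the apex bound).  Let `(w, π)` be a suitable weak solution on the
backward slab with weak gradient `H`, `𝐈 < ∞`, the apex bound `‖w(t, x)‖ ≤ C/(‖x‖ + √(−t))` almost
everywhere, and `|∫ ⟪w(s), φ⟫| ≤ ε` for a.e. `s ∈ (s₀, 0)` for every test field `φ` and `ε > 0`.
Then `w = 0` a.e. on `]-1/3, 0[ × ℝ³`; in particular the origin is not a backward singular point.
[cite: EscauriazaSereginSverak2003, Thm. 1.4 and §3] -/
theorem not_isBackwardSingularPoint_of_weakZeroScar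
    {w : ℝ → E³ → E³} {π : ℝ → E³ → ℝ} {H : ℝ → E³ → E³ →L[ℝ] E³}
    (hsw : IsSuitableWeakSolutionOn (slab E³ (Iio 0) isOpen_Iio) 1 0 w π)
    (hwg : HasWeakSpatialGradientOn (slab E³ (Iio 0) isOpen_Iio) w H)
    (hI : typeIBound (Iio (0 : ℝ) ×ˢ univ) w π H < ⊤) {C : ℝ}
    (hapex : ∀ᵐ z ∂(volume.restrict (Iio (0 : ℝ) ×ˢ (univ : Set E³))),
      ‖w z.1 z.2‖ ≤ C / (‖z.2‖ + Real.sqrt (-z.1)))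
    (htop : ∀ φ : E³ → E³, ContDiff ℝ (⊤ : ℕ∞) φ → HasCompactSupport φ → ∀ ε : ℝ, 0 < ε →
      ∃ s₀ : ℝ, s₀ < 0 ∧ ∀ᵐ s ∂(volume.restrict (Ioo s₀ 0)), |∫ y, ⟪w s y, φ y⟫| ≤ ε) :
    ¬ IsBackwardSingularPoint w 0 := by
  intro hsing
  -- ## the far field: `|w| ≤ 1` beyond `|x| = R₀`
  set R₀ : ℝ := max C 1 with hR₀def
  have hR₀ : 0 < R₀ := lt_of_lt_of_le one_pos (le_max_right _ _)
  have hfar : ∀ᵐ z ∂(volume.restrict (Ioo (-2 : ℝ) 0 ×ˢ (closedBall (0 : E³) R₀)ᶜ)), ‖w z.1 z.2‖ ≤ 1 := by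
    have hsub : Ioo (-2 : ℝ) 0 ×ˢ (closedBall (0 : E³) R₀)ᶜ ⊆ Iio (0 : ℝ) ×ˢ (univ : Set E³) :=
      prod_mono Ioo_subset_Iio_self (subset_univ _)
    filter_upwards [ae_restrict_of_ae_restrict_of_subset hsub hapex,
      ae_restrict_mem (measurableSet_Ioo.prod measurableSet_closedBall.compl)] with z hz hzmem
    have hx : R₀ < ‖z.2‖ := by
      have h := hzmem.2
      rw [mem_compl_iff, mem_closedBall, dist_zero_right, not_le] at h
      exact h
    have ht : z.1 < 0 := hzmem.1.2
    have hs : 0 < Real.sqrt (-z.1) := Real.sqrt_pos.2 (by linarith)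
    refine hz.trans ?_
    rcases le_or_gt C 0 with hC | hC
    · exact (div_nonpos_of_nonpos_of_nonneg hC (by positivity)).trans zero_le_one
    · rw [div_le_one (by positivity)]
      have : C ≤ R₀ := le_max_left _ _
      linarith
  obtain ⟨Uf, hUf, hUfc, hcurl⟩ := apex_farField_representative hsw hI htop hR₀ hfar
  -- ## the strips `]-1/3, -1/(n+4)[`
  have hstrip : ∀ n : ℕ, ∀ᵐ s ∂(volume.restrict (Ioo (-(1 / 3 : ℝ)) (-(1 / ((n : ℝ) + 4))))),
      w s =ᵐ[volume] 0 := by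
    intro n
    set b : ℝ := -(1 / ((n : ℝ) + 4)) with hbdef
    have hb : b < 0 := by rw [hbdef, neg_lt_zero]; positivity
    have hbd : ∀ᵐ z ∂(volume.restrict (Ioo (-(1 / 3 : ℝ) - 4 * (1 / 4 : ℝ) ^ 2) b ×ˢ (univ : Set E³))),
        ‖w z.1 z.2‖ ≤ max C 0 / Real.sqrt (-b) := by
      have hsub : Ioo (-(1 / 3 : ℝ) - 4 * (1 / 4 : ℝ) ^ 2) b ×ˢ (univ : Set E³) ⊆
          Iio (0 : ℝ) ×ˢ (univ : Set E³) := prod_mono (fun t ht => ht.2.trans hb) Subset.rfl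
      filter_upwards [ae_restrict_of_ae_restrict_of_subset hsub hapex,
        ae_restrict_mem (measurableSet_Ioo.prod MeasurableSet.univ)] with z hz hzmem
      have ht : z.1 < b := hzmem.1.2
      have hs : 0 < Real.sqrt (-z.1) := Real.sqrt_pos.2 (by linarith)
      have hsb : 0 < Real.sqrt (-b) := Real.sqrt_pos.2 (by linarith)
      calc ‖w z.1 z.2‖ ≤ C / (‖z.2‖ + Real.sqrt (-z.1)) := hz
        _ ≤ max C 0 / (‖z.2‖ + Real.sqrt (-z.1)) :=
            div_le_div_of_nonneg_right (le_max_left _ _) (by positivity)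
        _ ≤ max C 0 / Real.sqrt (-z.1) :=
            div_le_div_of_nonneg_left (le_max_right _ _) hs (le_add_of_nonneg_left (norm_nonneg _))
        _ ≤ max C 0 / Real.sqrt (-b) :=
            div_le_div_of_nonneg_left (le_max_right _ _) hsb (Real.sqrt_le_sqrt (by linarith))
    exact apex_strip_velocity_ae_zero hsw hwg hI hapex (by positivity : (0 : ℝ) < R₀ + 1) hUf hUfc
      hcurl (ρ := 1 / 4) (by norm_num) (by norm_num) hb.le hbd
  -- ## `w(s) = 0` a.e. for a.e. `s ∈ ]-1/3, 0[`
  have hae0 : ∀ᵐ s ∂(volume.restrict (Ioo (-(1 / 3 : ℝ)) 0)), w s =ᵐ[volume] 0 := by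
    have hcov : Ioo (-(1 / 3 : ℝ)) 0 ⊆ ⋃ n : ℕ, Ioo (-(1 / 3 : ℝ)) (-(1 / ((n : ℝ) + 4))) := by
      intro s hs
      obtain ⟨n, hn⟩ := exists_nat_one_div_lt (neg_pos.2 hs.2)
      refine mem_iUnion.2 ⟨n, hs.1, ?_⟩
      have h1 : 1 / ((n : ℝ) + 4) ≤ 1 / ((n : ℝ) + 1) :=
        one_div_le_one_div_of_le (by positivity) (by linarith)
      linarith
    refine ae_restrict_of_ae_restrict_of_subset hcov ?_
    rw [ae_restrict_iUnion_iff]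
    exact hstrip
  -- ## `w = 0` a.e. on `Q(0, 1/2)`: the origin is not singular
  have hQ : parabolicCylinder (1 / 2) (0 : ℝ × E³) = Ioo (-(1 / 4 : ℝ)) 0 ×ˢ ball (0 : E³) (1 / 2) := by
    rw [parabolicCylinder]
    simp only [Prod.fst_zero, Prod.snd_zero, zero_sub]
    norm_num
  have hwmQ : AEStronglyMeasurable (uncurry w)
      (volume.restrict (parabolicCylinder (1 / 2) (0 : ℝ × E³))) :=
    hwg.locallyIntegrableOn.aestronglyMeasurable.mono_measure
      (Measure.restrict_mono (parabolicCylinder_subset_slab _ le_rfl) le_rfl)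
  have hzero : ∫⁻ z in parabolicCylinder (1 / 2) (0 : ℝ × E³), ‖w z.1 z.2‖ₑ = 0 := by
    have hf : AEMeasurable (fun z : ℝ × E³ => ‖w z.1 z.2‖ₑ)
        ((volume.restrict (Ioo (-(1 / 4 : ℝ)) 0)).prod (volume.restrict (ball (0 : E³) (1 / 2)))) := by
      rw [Measure.prod_restrict, ← Measure.volume_eq_prod, ← hQ]
      exact hwmQ.enorm
    rw [hQ, Measure.volume_eq_prod, ← Measure.prod_restrict, lintegral_prod _ hf]
    refine (lintegral_congr_ae ?_).trans lintegral_zero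
    filter_upwards [ae_restrict_of_ae_restrict_of_subset (Ioo_subset_Ioo (by norm_num) le_rfl) hae0] with t ht
    refine (lintegral_congr_ae ?_).trans lintegral_zero
    filter_upwards [ae_restrict_of_ae ht] with x hx
    simp [hx]
  have hae : ∀ᵐ z ∂(volume.restrict (parabolicCylinder (1 / 2) (0 : ℝ × E³))), uncurry w z = (0 : ℝ × E³ → E³) z := by
    have h := (lintegral_eq_zero_iff' hwmQ.enorm).1 hzero
    filter_upwards [h] with ⟨t, x⟩ hz
    have hz' : ‖w t x‖ₑ = 0 := hz
    simpa using hz'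
  have h0 : eLpNorm (uncurry w) ⊤ (volume.restrict (parabolicCylinder (1 / 2) (0 : ℝ × E³))) = 0 :=
    (eLpNorm_eq_zero_iff hwmQ ENNReal.top_ne_zero).2 hae
  have h := hsing (1 / 2) (by norm_num)
  rw [h0] at h
  exact ENNReal.zero_ne_top h

/-! ### The item -/

/-- **NO MILD SCAR UNDER TYPE I** (route RellichScar, card P1; item stmt-NavierStokesRegularity-11723):
the scar of an apex Type-I profile singular at the origin is not in `L³` near the origin — no
`σ ∈ L³(B(0, r))` satisfies `esssup_{(−δ,0)×K} |u − σ| → 0` (`δ ↓ 0`) for all compact `K ∌ 0`.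
Proof: blow-up at the apex (`exists_blowup_limit_apex`), weak vanishing of the limit at the final
time because `L³` is scale critical (`top_vanishing_of_scar`), and rigidity of apex profiles with
weak zero scar (`not_isBackwardSingularPoint_of_weakZeroScar`).
[cite: EscauriazaSereginSverak2003, Thm. 1.4 and §3] [cite: AlbrittonBarker2019, Lemma 2.2, Prop. 2.3 and §3] -/
theorem rellichScar_noMildScar_proof :
    Summit.NavierStokesRegularity.NavierStokesRegularity.Theses.RellichScar.NoMildScar := by
  intro u p G C hsw hwg hI hdec hsing σ r hr hσ hscar
  -- ## blow-up at the apex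
  obtain ⟨w, π, H, c, hcpos, -, hc0, hsww, hH, hIw, hconv, hsingw, hapexw⟩ :=
    exists_blowup_limit_apex hsw hwg hI hdec hsing
  -- the limit is in `L³(Q(0, a))`
  have hwm : ∀ a : ℝ, 0 < a → MemLp (uncurry w) 3
      (volume.restrict (parabolicCylinder a (0 : ℝ × E³))) := by
    intro a ha
    refine ⟨hH.locallyIntegrableOn.aestronglyMeasurable.mono_measure
      (Measure.restrict_mono (parabolicCylinder_subset_slab a le_rfl) le_rfl), ?_⟩
    exact lt_of_le_of_lt (eLpNorm_velocity_slab_le ha π H) (ENNReal.rpow_lt_top_of_nonneg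
      (by norm_num) (ENNReal.mul_ne_top (ENNReal.pow_ne_top ENNReal.ofReal_ne_top) hIw.ne))
  -- ## the limit vanishes weakly at the final time
  have htop : ∀ φ : E³ → E³, ContDiff ℝ (⊤ : ℕ∞) φ → HasCompactSupport φ → ∀ ε : ℝ, 0 < ε →
      ∃ s₀ : ℝ, s₀ < 0 ∧ ∀ᵐ s ∂(volume.restrict (Ioo s₀ 0)), |∫ y, ⟪w s y, φ y⟫| ≤ ε :=
    fun φ hφ hφc ε hε => top_vanishing_of_scar hsw hwg hI hr hσ hscar hcpos hc0 hwm hconv hφ hφc hε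
  -- ## rigidity
  exact not_isBackwardSingularPoint_of_weakZeroScar hsww hH hIw hapexw htop hsingw

end Summit.NavierStokesRegularity.NavierStokesRegularity.Theorems.RellichScarNoMildScar

end
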